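import Summits.NavierStokesRegularity.NavierStokesRegularity.Theorems.SelfMixingDichotomyCoherentScaleExclusionKinWitnessSmooth
import Summits.NavierStokesRegularity.NavierStokesRegularity.Theorems.SelfMixingDichotomyCoherentScaleExclusionKinWitnessDivFree
import Literature.Analysis.FluidPDE.ClassicalSolution
import Mathlib.Analysis.SpecialFunctions.SmoothTransition
import HarnessLib

/-!
# Route SelfMixingDichotomy — crux `SequentialTypeIExclusion` (S1, stmt-NavierStokesRegularity-1424), line `registered`,
# lead c6 (pulsating witness package): stub `pulse_smooth_divFree` (W6)

Support file (`--supports stmt-NavierStokesRegularity-1424`): lands the registered sub-goal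
`pulse_smooth_divFree` of the lead's sub-skeleton `…SequentialTypeIExclusionPulsatingWitness` — SMOOTHNESS on
`[0,1) × ℝ³` and INCOMPRESSIBILITY at every time of the pulsating self-similar swirling eddy

  `u t x = (a t · (1 − t)⁻¹ · expNegInvGlue (4 − ‖x‖²/(1 − t))) • (−x₁, x₀, 0)`   (`t < 1`; `0` after),

for an amplitude `a : ℝ → ℝ` smooth on `(−∞, 1)`. This is the regime-A eddy of the sibling crux S2 with the
constant amplitude `A` replaced by `a t`; the proof is steps (1) and (5) of `coherentTypeI_kinematicWitness`
verbatim: joint smoothness on `(−∞,1) × ℝ³` by `kinWitness_contDiffOn_swirlField` with `g t = a t (1 − t)⁻¹`,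
`h t = 1 − t`, `φ s = expNegInvGlue (4 − s)`, then restriction to `[0,1) ⊂ (−∞,1)`; divergence-freeness of each
slice `t < 1` by `kinWitness_isDivFree_swirlField` with `φ s = expNegInvGlue (4 − s/(1 − t))` and amplitude
`a t (1 − t)⁻¹`, the slices `t ≥ 1` being the zero field.
-/

noncomputable section

open MeasureTheory Set Metric Function
open scoped ENNReal ContDiff
open Literature.Analysis.FluidPDE

-- `Summit = Problem` for this summit; the tree lakefile sets `weak.linter.dupNamespace = false`.
set_option linter.dupNamespace false

namespace Summit.NavierStokesRegularity.NavierStokesRegularity.Theorems.SequentialTypeIExclusion.Registered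

/-- Joint smoothness of the pulsating eddy on the OPEN half-space–time `(−∞, 1) × ℝ³`, for an amplitude `a`
smooth on `(−∞, 1)`: `kinWitness_contDiffOn_swirlField` with `g t = a t (1 − t)⁻¹`, `h t = 1 − t`,
`φ s = expNegInvGlue (4 − s)` on `S = Iio 1`, then `ContDiffOn.congr` (the `if` is true there). -/
theorem pulse_smooth_divFree_contDiffOn_Iio (a : ℝ → ℝ) (ha : ContDiffOn ℝ (⊤ : ℕ∞) a (Set.Iio 1)) :
    ContDiffOn ℝ ∞ (Function.uncurry (fun (t : ℝ) (x : EuclideanSpace ℝ (Fin 3)) => if t < 1 then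
        (a t * (1 - t)⁻¹ * expNegInvGlue (4 - ‖x‖ ^ 2 / (1 - t))) •
          (WithLp.toLp 2 ![-(x 1), x 0, 0] : EuclideanSpace ℝ (Fin 3)) else 0))
      (Set.Iio 1 ×ˢ (Set.univ : Set (EuclideanSpace ℝ (Fin 3)))) := by
  have hφ : ContDiff ℝ ((⊤ : ℕ∞) : WithTop ℕ∞) (fun s : ℝ => expNegInvGlue (4 - s)) :=
    expNegInvGlue.contDiff.comp (contDiff_const.sub contDiff_id)
  have hh0 : ∀ t ∈ Set.Iio (1 : ℝ), (1 - t) ≠ 0 := by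
    intro t ht
    have : t < 1 := ht
    exact (sub_pos.2 this).ne'
  have hh : ContDiffOn ℝ ((⊤ : ℕ∞) : WithTop ℕ∞) (fun t : ℝ => (1 - t)) (Set.Iio 1) :=
    (contDiffOn_const.sub contDiffOn_id)
  have hg : ContDiffOn ℝ ((⊤ : ℕ∞) : WithTop ℕ∞) (fun t : ℝ => a t * (1 - t)⁻¹) (Set.Iio 1) :=
    ha.mul (hh.inv hh0)
  have h := kinWitness_contDiffOn_swirlField (fun s : ℝ => expNegInvGlue (4 - s)) hφ
    (fun t : ℝ => a t * (1 - t)⁻¹) (fun t : ℝ => (1 - t)) (Set.Iio 1) isOpen_Iio hg hh hh0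
  refine h.congr ?_
  rintro ⟨t, x⟩ hp
  have ht : t < 1 := (Set.mem_prod.1 hp).1
  simp only [Function.uncurry_apply_pair, if_pos ht]

/-- Every time slice of the pulsating eddy is divergence free: for `t < 1` it is the swirl field
`x ↦ ((a t (1 − t)⁻¹) · φ(‖x‖²)) • (−x₁, x₀, 0)` with `φ s = expNegInvGlue (4 − s/(1 − t))`
(`kinWitness_isDivFree_swirlField`); for `t ≥ 1` it is the zero field. -/
theorem pulse_smooth_divFree_isDivFree (a : ℝ → ℝ) (t : ℝ) :
    Literature.Analysis.FluidPDE.VectorCalculus.IsDivFree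
      ((fun (t : ℝ) (x : EuclideanSpace ℝ (Fin 3)) => if t < 1 then
        (a t * (1 - t)⁻¹ * expNegInvGlue (4 - ‖x‖ ^ 2 / (1 - t))) •
          (WithLp.toLp 2 ![-(x 1), x 0, 0] : EuclideanSpace ℝ (Fin 3)) else 0) t) := by
  by_cases ht : t < 1
  · have hφ : ContDiff ℝ 1 (fun s : ℝ => expNegInvGlue (4 - s / (1 - t))) :=
      expNegInvGlue.contDiff.comp (contDiff_const.sub (contDiff_id.div_const _))
    have h := kinWitness_isDivFree_swirlField _ hφ (a t * (1 - t)⁻¹)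
    have hfun : ((fun (t : ℝ) (x : EuclideanSpace ℝ (Fin 3)) => if t < 1 then
        (a t * (1 - t)⁻¹ * expNegInvGlue (4 - ‖x‖ ^ 2 / (1 - t))) •
          (WithLp.toLp 2 ![-(x 1), x 0, 0] : EuclideanSpace ℝ (Fin 3)) else 0) t) =
        fun x : EuclideanSpace ℝ (Fin 3) =>
          ((a t * (1 - t)⁻¹) * expNegInvGlue (4 - ‖x‖ ^ 2 / (1 - t))) •
            (WithLp.toLp 2 ![-(x 1), x 0, 0] : EuclideanSpace ℝ (Fin 3)) := by
      funext x
      simp only [if_pos ht]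
    rw [hfun]
    exact h
  · have hfun : ((fun (t : ℝ) (x : EuclideanSpace ℝ (Fin 3)) => if t < 1 then
        (a t * (1 - t)⁻¹ * expNegInvGlue (4 - ‖x‖ ^ 2 / (1 - t))) •
          (WithLp.toLp 2 ![-(x 1), x 0, 0] : EuclideanSpace ℝ (Fin 3)) else 0) t) =
        fun _ : EuclideanSpace ℝ (Fin 3) => (0 : EuclideanSpace ℝ (Fin 3)) := by
      funext x
      simp only [if_neg ht]
    rw [hfun]
    intro x
    simp [VectorCalculus.divergence]

/-- **W6 — smoothness before the blow-up time and incompressibility** (registered sub-goal `pulse_smooth_divFree`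
of crux stmt-NavierStokesRegularity-1424, line `registered`, lead c6, pulsating witness package). For an
amplitude `a` smooth on `(−∞, 1)` the pulsating eddy is jointly smooth on `[0, 1) × ℝ³`
(`pulse_smooth_divFree_contDiffOn_Iio` restricted to `Ico 0 1 ⊂ Iio 1`) and every slice is divergence free
(`pulse_smooth_divFree_isDivFree`). -/
theorem pulse_smooth_divFree :
    ∀ a : ℝ → ℝ, ContDiffOn ℝ (⊤ : ℕ∞) a (Set.Iio 1) →
      Literature.Analysis.FluidPDE.IsSmoothSpaceTimeOn (Set.Ico 0 1) (fun (t : ℝ) (x : EuclideanSpace ℝ (Fin 3)) => if t < 1 then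
          (a t * (1 - t)⁻¹ * expNegInvGlue (4 - ‖x‖ ^ 2 / (1 - t))) •
            (WithLp.toLp 2 ![-(x 1), x 0, 0] : EuclideanSpace ℝ (Fin 3)) else 0) ∧
      ∀ t : ℝ, Literature.Analysis.FluidPDE.VectorCalculus.IsDivFree ((fun (t : ℝ) (x : EuclideanSpace ℝ (Fin 3)) => if t < 1 then
          (a t * (1 - t)⁻¹ * expNegInvGlue (4 - ‖x‖ ^ 2 / (1 - t))) •
            (WithLp.toLp 2 ![-(x 1), x 0, 0] : EuclideanSpace ℝ (Fin 3)) else 0) t) := by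
  intro a ha
  refine ⟨?_, fun t => pulse_smooth_divFree_isDivFree a t⟩
  exact (pulse_smooth_divFree_contDiffOn_Iio a ha).mono (Set.prod_mono (fun _ ht => ht.2) Subset.rfl)

end Summit.NavierStokesRegularity.NavierStokesRegularity.Theorems.SequentialTypeIExclusion.Registered

end
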